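import Summits.ValiantsHypothesis.ValiantsHypothesis.Theorems.DepthWindowHomNewtonStep
import Summits.ValiantsHypothesis.ValiantsHypothesis.Theorems.DepthWindowHomFanIn
import Summits.ValiantsHypothesis.ValiantsHypothesis.Theorems.DepthWindowSlopeRate
import HarnessLib

/-!
# Route `DepthWindow`, g8 — `HomRel k (2k)` (kernel): LST Lemma 11 in the weighted gate-list model

`homRel_two_mul (k) : HomRel k (2 * k)`: a block of relative product-depth `k` (positive weights,
truncation order `d`) is replaced by a `w`-homogeneous block of relative product-depth `≤ 2k`, size
`≤ (s + |τ| + d + 2)^8 · 2^(8 d²)`, with operands reading every weighted-homogeneous component of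
weight `≤ d` of every old gate.  Two stages: (N) Newton normalisation (`newton_normalise`, this
file, by induction on the block with `DepthWindowHomNewtonStep.newton_step`): product fan-in
`≤ 2d`, values preserved modulo weight `> d` (`DepthWindowNewtonTrunc.below`), depth entries at
most doubled; (F) gate-local homogenisation at bounded fan-in
(`DepthWindowHomFanIn.exists_hom_block_of_fanIn`), depth entries preserved.  Corollaries:
`homRel_one_two : HomRel 1 2`, `homAtSlope_two_one : HomAtSlope 2 1` (with the stacking theorem
`homAtSlope_of_homRel`), and the one-hypothesis reduction
`perHardLog3_of_homImmHardAt_two_one : HomImmHardAt 2 1 → PerHardLog3` of the crux `PerHardLog3`.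

This is the depth-RATE-2 rung of the route's homogenisation dial (print: LST25 Lemma 11 /
Strassen 1973); the crux item `HomSubReach` asks for rate `≤ 7/5` and is NOT touched by this file.

[cite: LimayeSrinivasanTavenas2025, Lemma 11, Lemma 19, Lemma 20] [cite: Strassen1973, §3]
[cite: Burgisser2000, Def. 2.1]
-/

-- layout Summits/ValiantsHypothesis/ValiantsHypothesis forces the duplicated namespace component
set_option linter.dupNamespace false

namespace Summit.ValiantsHypothesis.ValiantsHypothesis.Theorems.DepthWindow

open MvPolynomial Literature.Computability.AlgebraicComplexity ArithCircuit
open Literature.Computability.AlgebraicComplexity.DepthReduction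
/-! ### Stage N: the Newton normalisation of a whole block -/

section Normalise

variable {k : Type*} [Field k] [Algebra ℚ k] {τ : Type*}

/-- **Newton normalisation of a block.**  Every block `Φ` is simulated, modulo weight `> d`, by a
block `Φ'` whose product gates have fan-in `≤ 2d`, with `|Φ'| ≤ |Φ| · (|Φ| + d + 2)² · 2^(d+2)`,
every depth entry at most twice an old one, and positions `pos j` carrying the old values modulo
weight `> d` at depth `≤ 2 ·` (old entry).  Induction on the block with `newton_step`.
[cite: LimayeSrinivasanTavenas2025, Lemma 11] [cite: Strassen1973, §3] -/
theorem newton_normalise (w : τ → ℕ) (hw : ∀ t, 1 ≤ w t) (d : ℕ) :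
    ∀ Φ : List (Gate k τ), ∃ (Φ' : List (Gate k τ)) (pos : ℕ → ℕ),
      (∀ vs : List (Operand k τ), Gate.prod vs ∈ Φ' → vs.length ≤ 2 * d) ∧
      Φ'.length ≤ Φ.length * ((Φ.length + d + 2) ^ 2 * 2 ^ (d + 2)) ∧
      (∀ x ∈ gateWDepths prodWeight Φ', ∃ y ∈ gateWDepths prodWeight Φ, x ≤ 2 * y) ∧
      ∀ j < Φ.length, pos j < Φ'.length ∧
        below w (d + 1) ((gateValues Φ').getD (pos j) 0) =
          below w (d + 1) ((gateValues Φ).getD j 0) ∧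
        (gateWDepths prodWeight Φ').getD (pos j) 0 ≤ 2 * (gateWDepths prodWeight Φ).getD j 0 := by
  intro Φ
  induction Φ using List.reverseRecOn with
  | nil =>
      exact ⟨[], id, by simp, by simp, by simp [gateWDepths],
        fun j hj => absurd hj (Nat.not_lt_zero j)⟩
  | append_singleton gs g ih =>
      obtain ⟨Φ₀, pos₀, hF, hL, hD, hP⟩ := ih
      have hvals : (gateValues gs).length = gs.length := gateValues_length gs
      have hds : (gateWDepths prodWeight gs).length = gs.length := gateWDepths_length prodWeight gs
      have hV₀len : (gateValues Φ₀).length = Φ₀.length := gateValues_length Φ₀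
      have hD₀len : (gateWDepths prodWeight Φ₀).length = Φ₀.length :=
        gateWDepths_length prodWeight Φ₀
      obtain ⟨Y, hYF, hYL, hYpos, hYD, hYV, hYdep⟩ :=
        newton_step w hw d Φ₀ gs.length pos₀ (gateValues gs) (gateWDepths prodWeight gs)
          (fun j hj => (hP j hj).1) hvals (fun j hj => (hP j hj).2.1) (fun j hj => (hP j hj).2.2) g
      have hGV : gateValues (gs ++ [g]) = gateValues gs ++ [g.eval (gateValues gs)] :=
        gateValues_append_singleton gs g
      have hGD : gateWDepths prodWeight (gs ++ [g]) =
          gateWDepths prodWeight gs ++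
            [Gate.depthAgainst prodWeight (gateWDepths prodWeight gs) g] :=
        gateWDepths_append_singleton prodWeight gs g
      obtain ⟨XV, hXV, -⟩ := gateValues_prefix Φ₀ Y
      obtain ⟨XD, hXD, -⟩ := gateWDepths_prefix prodWeight Φ₀ Y
      refine ⟨Φ₀ ++ Y, fun j => if j < gs.length then pos₀ j else Φ₀.length + Y.length - 1,
        ?_, ?_, ?_, ?_⟩
      · intro vs hvs
        rcases List.mem_append.mp hvs with h | h
        · exact hF vs h
        · exact hYF vs h
      · have hA : (gs.length + d + 2) ^ 2 * 2 ^ (d + 2) ≤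
            ((gs ++ [g]).length + d + 2) ^ 2 * 2 ^ (d + 2) := by
          rw [List.length_append, List.length_singleton]
          exact Nat.mul_le_mul_right _ (Nat.pow_le_pow_left (by omega) 2)
        calc (Φ₀ ++ Y).length = Φ₀.length + Y.length := List.length_append
          _ ≤ gs.length * ((gs.length + d + 2) ^ 2 * 2 ^ (d + 2)) +
                (gs.length + d + 2) ^ 2 * 2 ^ (d + 2) := Nat.add_le_add hL hYL
          _ = (gs ++ [g]).length * ((gs.length + d + 2) ^ 2 * 2 ^ (d + 2)) := by
                rw [List.length_append, List.length_singleton]; ring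
          _ ≤ (gs ++ [g]).length * (((gs ++ [g]).length + d + 2) ^ 2 * 2 ^ (d + 2)) :=
                Nat.mul_le_mul_left _ hA
      · intro x hx
        rcases hYD x hx with h | h
        · obtain ⟨y, hy, hxy⟩ := hD x h
          exact ⟨y, by rw [hGD]; exact List.mem_append_left _ hy, hxy⟩
        · exact ⟨_, by rw [hGD]; exact List.mem_append_right _ (List.mem_singleton_self _), h⟩
      · intro j hj
        rw [List.length_append, List.length_singleton] at hj
        by_cases hjl : j < gs.length
        · obtain ⟨hp1, hp2, hp3⟩ := hP j hjl
          simp only [if_pos hjl]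
          refine ⟨by rw [List.length_append]; omega, ?_, ?_⟩
          · rw [hXV, List.getD_append _ _ _ _ (by rw [hV₀len]; exact hp1), hGV,
              List.getD_append _ _ _ _ (by rw [hvals]; exact hjl)]
            exact hp2
          · rw [hXD, List.getD_append _ _ _ _ (by rw [hD₀len]; exact hp1), hGD,
              List.getD_append _ _ _ _ (by rw [hds]; exact hjl)]
            exact hp3
        · have hje : j = gs.length := by omega
          subst hje
          simp only [lt_irrefl, if_false]
          refine ⟨by rw [List.length_append]; omega, ?_, ?_⟩
          · rw [hYV, hGV, getD_append_at_length _ _ _ hvals.symm]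
          · rw [hGD, getD_append_at_length _ _ _ hds.symm]
            exact hYdep

end Normalise

/-! ### The budget arithmetic -/

/-- `2d + 2 ≤ 2^(d+1)`. -/
theorem two_mul_add_two_le_pow (d : ℕ) : 2 * d + 2 ≤ 2 ^ (d + 1) := by
  induction d with
  | zero => norm_num
  | succ n ih => rw [pow_succ]; omega

/-- The size bookkeeping of `homRel_two_mul`: Newton normalisation times homogenisation at
fan-in `2d` fits the `HomRel` budget with exponent `8`. -/
theorem budget_two_mul (S V d L₁ L₂ : ℕ)
    (h1 : L₁ ≤ S * ((S + d + 2) ^ 2 * 2 ^ (d + 2)))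
    (h2 : L₂ ≤ L₁ * ((d + 1) * ((2 * d + 1) ^ d + 1))) :
    L₂ ≤ (S + V + d + 2) ^ 8 * 2 ^ (8 * d * d) := by
  set T := S + V + d + 2 with hT
  have hT2 : 2 ≤ T := by omega
  have hST : S ≤ T := by omega
  have hA : (S + d + 2) ^ 2 ≤ T ^ 2 := Nat.pow_le_pow_left (by omega) 2
  have hdT : d + 1 ≤ T := by omega
  have h4 : 2 * d + 1 ≤ 2 ^ (d + 1) := (Nat.le_succ _).trans (two_mul_add_two_le_pow d)
  have h5 : (2 * d + 1) ^ d + 1 ≤ 2 ^ (d * (d + 1) + 1) := by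
    have h5a : (2 * d + 1) ^ d ≤ 2 ^ (d * (d + 1)) := by
      calc (2 * d + 1) ^ d ≤ (2 ^ (d + 1)) ^ d := Nat.pow_le_pow_left h4 d
        _ = 2 ^ (d * (d + 1)) := by rw [← pow_mul, Nat.mul_comm]
    have h5b : 1 ≤ 2 ^ (d * (d + 1)) := Nat.one_le_two_pow
    rw [pow_succ]; omega
  have h6 : 8 ≤ T ^ 3 := by
    calc (8 : ℕ) = 2 ^ 3 := by norm_num
      _ ≤ T ^ 3 := Nat.pow_le_pow_left hT2 3
  have h7 : d * d + 2 * d + 3 ≤ 3 * (d * d) + 3 := by nlinarith [Nat.zero_le d, Nat.le_mul_self d]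
  have h8 : T ^ 7 ≤ T ^ 8 := Nat.pow_le_pow_right (by omega) (by norm_num)
  have h9 : 2 ^ (3 * (d * d)) ≤ 2 ^ (8 * d * d) :=
    Nat.pow_le_pow_right (by norm_num) (by rw [Nat.mul_assoc]; omega)
  calc L₂ ≤ L₁ * ((d + 1) * ((2 * d + 1) ^ d + 1)) := h2
    _ ≤ (S * ((S + d + 2) ^ 2 * 2 ^ (d + 2))) * ((d + 1) * ((2 * d + 1) ^ d + 1)) :=
          Nat.mul_le_mul_right _ h1
    _ ≤ (T * (T ^ 2 * 2 ^ (d + 2))) * (T * 2 ^ (d * (d + 1) + 1)) :=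
          Nat.mul_le_mul (Nat.mul_le_mul hST (Nat.mul_le_mul_right _ hA))
            (Nat.mul_le_mul hdT h5)
    _ = T ^ 4 * 2 ^ (d * d + 2 * d + 3) := by ring
    _ ≤ T ^ 4 * 2 ^ (3 * (d * d) + 3) :=
          Nat.mul_le_mul_left _ (Nat.pow_le_pow_right (by norm_num) h7)
    _ = T ^ 4 * 8 * 2 ^ (3 * (d * d)) := by ring
    _ ≤ T ^ 4 * T ^ 3 * 2 ^ (8 * d * d) :=
          Nat.mul_le_mul (Nat.mul_le_mul_left _ h6) h9
    _ = T ^ 7 * 2 ^ (8 * d * d) := by ring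
    _ ≤ T ^ 8 * 2 ^ (8 * d * d) := Nat.mul_le_mul_right _ h8

/-! ### `HomRel k (2k)` and its corollaries -/

/-- **`HomRel k (2k)` (kernel).**  The relative homogenisation block lemma at product-depth rate
`2` — the weighted gate-list form of Strassen's homogenisation as organised in
[LST25, Lemma 11]: a block of relative product-depth `k` is replaced by a `w`-homogeneous block of
relative product-depth `≤ 2k` computing all weighted-homogeneous components up to `d` of all the
old gates, of size `≤ (s + |τ| + d + 2)^8 · 2^(8d²)`.  Proof: Newton normalisation to product
fan-in `≤ 2d` (`newton_normalise`, depth factor `2`), then gate-by-gate homogenisation at bounded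
fan-in (`exists_hom_block_of_fanIn`, depth factor `1`).
[cite: LimayeSrinivasanTavenas2025, Lemma 11] [cite: Strassen1973, §3]
[cite: Burgisser2000, Def. 2.1] -/
theorem homRel_two_mul (kk : ℕ) : HomRel kk (2 * kk) := by
  refine ⟨8, ?_⟩
  intro τ _ w hw d Φ hΦ
  obtain ⟨Φ', pos, hF, hL, hD, hP⟩ := newton_normalise (k := ℂ) w hw d Φ
  obtain ⟨Ψ, out, hhom, hΨL, hΨD, hout⟩ := exists_hom_block_of_fanIn (2 * d) w d Φ' hF
  refine ⟨Ψ, fun i e => out (pos i) e, hhom, ?_, ?_, ?_⟩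
  · intro n hn
    obtain ⟨y, hy, hny⟩ := hΨD n hn
    obtain ⟨z, hz, hyz⟩ := hD y hy
    have := hΦ z hz
    calc n ≤ y := hny
      _ ≤ 2 * z := hyz
      _ ≤ 2 * kk := Nat.mul_le_mul_left 2 this
  · exact budget_two_mul Φ.length (Fintype.card τ) d Φ'.length Ψ.length hL hΨL
  · intro i e hi he
    obtain ⟨h1, h2, -⟩ := hout (pos i) e (hP i hi).1 he
    refine ⟨h1, ?_⟩
    rw [h2]
    exact weightedHomogeneousComponent_eq_of_below_eq w (hP i hi).2.1 (by omega)

/-- `HomRel 1 2`: the LST Lemma-11 instance (relative product-depth `1 ↦ 2`). -/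
theorem homRel_one_two : HomRel 1 2 := homRel_two_mul 1

/-- `HomRel 2 4`. -/
theorem homRel_two_four : HomRel 2 4 := homRel_two_mul 2

/-- **The depth-rate-`2` homogenisation dial value is a theorem**: `HomAtSlope 2 1`
(homogenisation of product-depth-`Δ` circuits in product depth `2Δ + O(1)` at quasipolynomial
cost in the degree), from `homRel_one_two` and the stacking theorem `homAtSlope_of_homRel`.
[cite: LimayeSrinivasanTavenas2025, Lemma 11, Lemma 19, Lemma 20] -/
theorem homAtSlope_two_one : HomAtSlope 2 1 := homAtSlope_of_homRel Nat.one_pos homRel_one_two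

/-- **Rate-2 reduction of the crux `PerHardLog3`** (kernel): with homogenisation at rate `2` now
proved, `PerHardLog3` follows from the immanant-hardness half at the matching window,
`HomImmHardAt 2 1`, alone. -/
theorem perHardLog3_of_homImmHardAt_two_one (hHard : HomImmHardAt 2 1) :
    _root_.Summit.ValiantsHypothesis.ValiantsHypothesis.Theses.DepthWindow.PerHardLog3 :=
  perHardLog3_of_rate_two homRel_one_two hHard

end Summit.ValiantsHypothesis.ValiantsHypothesis.Theorems.DepthWindow
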